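import Summits.ResolutionOfSingularities.ResolutionOfSingularities.Theorems.CuspCutCells2
import Summits.ResolutionOfSingularities.ResolutionOfSingularities.Theorems.MaxContactCutOddCrossCut
import HarnessLib

/-!
# MaxContactCutCuspCut — decomp-res node «CuspCut» (lens-2 g24, critic row 197 BOOKED 0), tree file 6/6 of the node

Content VERBATIM from the decomp-res lens-2 g24 node `HOME/decomp-res-lens-2/g24/CuspCut.lean` (pin 4f3dedd1; no
carry, imports the landed tree only; ns `…Theses.CuspCut` ↦ `…Theorems.CuspCut`); HOME =
run/shared/lean/pub/decomp-res; critic CRITIC-LEDGER row 197 BOOKED 0; landing orders INBOX :1164 / :1194 —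
provenance, critic text and the lens header in full in the first file of the node, `CuspCutKernels`.  `--kind proof
--supports stmt-ResolutionOfSingularities-29273`.

## This file

THE WIRING of the node VERBATIM, BY NAME on the host route `MaxContactCut` (Theses cone; `namespace CuspX`, `section
Kernels`), in lens order: `CuspX.rungOne_iff` · `CuspX.cuspGenericRung_of_rungOne` ·
`CuspX.cuspSpecialRung_of_rungOne` · `CuspX.cuspSpecialRung_iff_rungOne` · `CuspX.closes` ·
`CuspX.cuspGenericRung_of_ports` · `CuspX.closes_of_engines` · `CuspX.oddSpecialRung_iff_cuspSpecialRung` ·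
`CuspX.deepSpecialRung_iff_cuspSpecialRung` · `CuspX.crossSpecialRung_iff_cuspSpecialRung` ·
`CuspX.spreadSpecialRung_iff_cuspSpecialRung` · `CuspX.pinchSpecialRung_iff_cuspSpecialRung` ·
`CuspX.leafSpecialRung_iff_cuspSpecialRung` · `CuspX.leafGenericRung_of_cuspGenericRung` ·
`CuspX.closes_of_oddSpecialRung` · `CuspX.odd_closes_of_cusp` — `CuspX.rungOne_iff : MaxContactCut.RungOne ⟺
CuspGenericRung ∧ CuspSpecialRung`, **`CuspX.closes`**, the engine / port forms, and the §E.3 EXACT RE-LOCATIONS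
(the residual shrinks; equivalent modulo the cusp decided half) incl. **`leafSpecialRung_iff_cuspSpecialRung`**
(tree aside 33866 ⟺ the cusp residual modulo the generic rung) and `odd_closes_of_cusp`.  Imports the last
`CuspCutCells…` part + `MaxContactCutOddCrossCut`; 0 sorry.

[WRITER NOTE (decomp-res writer g13): file split only (tree files ≤ 400 lines); sections, section variables / opens
and every declaration exactly as in the lens (the node's HOME-only dupNamespace-linter line is dropped; the
namespace-level `open` lines of the node are replayed in every part, the `open …Theses` line only in the Theses-cone
file `MaxContactCutCuspCut`); namespace renamed `…Theses.CuspCut` ↦ `…Theorems.CuspCut`.]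

(Sources: Hironaka1964 Ch. III; CossartJannsenSaito2020 Thm 5.9, Ch. 2, Ch. 8–9; Cutkosky2009 Thm 5.6, Thm 7.2,
Lemma 7.3, §8; Kollar2007 §3.13 (3.111); CossartPiltant2008 Prop. 4.2; CossartPiltant2019 Rem. 3.2;
EncinasVillamayor2000; BierstoneGrigorievMilmanWlodarczyk2011 §3.1; Moh1987; Hauser2010Kangaroo; Giraud1975.)
-/

open CategoryTheory AlgebraicGeometry TopologicalSpace IsLocalRing
open Literature.AlgebraicGeometry.Resolution
open Summit.ResolutionOfSingularities.ResolutionOfSingularities.Theorems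
open Summit.ResolutionOfSingularities.ResolutionOfSingularities.Theorems.WeakOrderReduction
open Summit.ResolutionOfSingularities.ResolutionOfSingularities.Theorems.DeltaFaceCutClasses
open Summit.ResolutionOfSingularities.ResolutionOfSingularities.Theorems.RelativeDeltaCut
open Summit.ResolutionOfSingularities.ResolutionOfSingularities.Theorems.CurveLeafExit
open Summit.ResolutionOfSingularities.ResolutionOfSingularities.Theorems.PinchCut
open Summit.ResolutionOfSingularities.ResolutionOfSingularities.Theorems.JetCut
open Summit.ResolutionOfSingularities.ResolutionOfSingularities.Theorems.PurityCut
open Summit.ResolutionOfSingularities.ResolutionOfSingularities.Theorems.SplitCut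
open Summit.ResolutionOfSingularities.ResolutionOfSingularities.Theorems.CylinderCut
open Summit.ResolutionOfSingularities.ResolutionOfSingularities.Theorems.SpreadCut
open Summit.ResolutionOfSingularities.ResolutionOfSingularities.Theorems.CrossCut
open Summit.ResolutionOfSingularities.ResolutionOfSingularities.Theorems.DeepCrossCut
open Summit.ResolutionOfSingularities.ResolutionOfSingularities.Theorems.OddCrossCut
open Summit.ResolutionOfSingularities.ResolutionOfSingularities.Theses

namespace Summit.ResolutionOfSingularities.ResolutionOfSingularities.Theorems.CuspCut

namespace CuspX

section Kernels

variable {n : ℕ}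

/-- **EXACT AT THE RUNG** (the ONE equivalence layer of this node): `RungOne ⟺ CuspGenericRung ∧ CuspSpecialRung`.
[folklore] -/
theorem rungOne_iff : MaxContactCut.RungOne ↔ CuspGenericRung ∧ CuspSpecialRung :=
  Leaf.rungOne_iff (L := cuspLeaf)

/-- NECESSITY by letter. [folklore] -/
theorem cuspGenericRung_of_rungOne (h : MaxContactCut.RungOne) : CuspGenericRung := (rungOne_iff.mp h).1

/-- NECESSITY by letter. [folklore] -/
theorem cuspSpecialRung_of_rungOne (h : MaxContactCut.RungOne) : CuspSpecialRung := (rungOne_iff.mp h).2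

/-- HONESTY KERNEL: modulo the decided half, the located residual IS the rung (cofinal). [folklore] -/
theorem cuspSpecialRung_iff_rungOne (hG : CuspGenericRung) : CuspSpecialRung ↔ MaxContactCut.RungOne :=
  Leaf.specialRung_iff_rungOne (L := cuspLeaf) hG

/-- **DECIDING IMPLICATION OF THE NODE**: `MaxContactCut.RungOne` (29273) BY NAME from the two halves. [folklore] -/
theorem closes (hG : CuspGenericRung) (hS : CuspSpecialRung) : MaxContactCut.RungOne :=
  Leaf.closes (L := cuspLeaf) hG hS

/-- **`CuspGenericRung` with the cylinder engine DISCHARGED by the ports** (X1 via the TREE aside 30081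
`MaxContactCut.MaxOrderThreefoldResolution` BY NAME). [folklore] -/
theorem cuspGenericRung_of_ports (hV : VeryNearCutClasses.VeryNearExit) (hD : DeltaPackageExit)
    (hU : UniformCurvePackageExit) (hR : RelCurvePackageExit) (hN : NormalConeJumpExit)
    (hM : MonomialPinchExit) (hC : FlatConeExit) (hGE : GrandExit) (hSE : SplitConeExit)
    (hJE : JetCylinderExit) (hX : MaxContactCut.MaxOrderThreefoldResolution) (hΓE : SpreadExit) (hXE : CrossExit)
    (hDXE : DeepCrossExit) (hNE : NodeExit) (hOXE : OddCrossExit) (hCuE : CuspExit) (hTaE : TameTwoExit)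
    (hP : ∀ n : ℕ, 2 ≤ n → ComponentPackagePort n) (h1 : FaceFormCutClasses.OrderOneContact) : CuspGenericRung :=
  cuspGenericRung_of_engines hV hD hU hR hN hM hC hGE hSE (cylinderExit_of_ports hJE hX) hJE hΓE hXE hDXE hNE hOXE
    hCuE hTaE hP h1

/-- `RungOne` BY NAME from the engines, the ports and the located residual. [folklore] -/
theorem closes_of_engines (hV : VeryNearCutClasses.VeryNearExit) (hD : DeltaPackageExit)
    (hU : UniformCurvePackageExit) (hR : RelCurvePackageExit) (hN : NormalConeJumpExit)
    (hM : MonomialPinchExit) (hC : FlatConeExit) (hGE : GrandExit) (hSE : SplitConeExit)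
    (hJE : JetCylinderExit) (hX : MaxContactCut.MaxOrderThreefoldResolution) (hΓE : SpreadExit) (hXE : CrossExit)
    (hDXE : DeepCrossExit) (hNE : NodeExit) (hOXE : OddCrossExit) (hCuE : CuspExit) (hTaE : TameTwoExit)
    (hP : ∀ n : ℕ, 2 ≤ n → ComponentPackagePort n) (h1 : FaceFormCutClasses.OrderOneContact)
    (hS : CuspSpecialRung) : MaxContactCut.RungOne :=
  closes (cuspGenericRung_of_ports hV hD hU hR hN hM hC hGE hSE hJE hX hΓE hXE hDXE hNE hOXE hCuE hTaE hP h1) hS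

/-- **EXACT RE-LOCATION OF THE TREE's g23 `OddX.OddSpecialRung`** (the located residual the instruction names): modulo
the cusp decided half, `OddX.OddSpecialRung ⟺ CuspSpecialRung`. [folklore] -/
theorem oddSpecialRung_iff_cuspSpecialRung (hG : CuspGenericRung) : OddX.OddSpecialRung ↔ CuspSpecialRung :=
  OddX.oddSpecialRung_iff.trans (Leaf.specialRung_iff_of_le oddLeaf_le_cuspLeaf hG)

/-- **EXACT RE-LOCATION OF g22's `Deep.DeepSpecialRung`**: modulo the cusp decided half. [folklore] -/
theorem deepSpecialRung_iff_cuspSpecialRung (hG : CuspGenericRung) : Deep.DeepSpecialRung ↔ CuspSpecialRung :=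
  (OddX.deepSpecialRung_iff_oddSpecialRung (oddGenericRung_of_cuspGenericRung hG)).trans
    (oddSpecialRung_iff_cuspSpecialRung hG)

/-- **EXACT RE-LOCATION OF g20's `Cross.CrossSpecialRung`**: modulo the cusp decided half. [folklore] -/
theorem crossSpecialRung_iff_cuspSpecialRung (hG : CuspGenericRung) : Cross.CrossSpecialRung ↔ CuspSpecialRung :=
  (OddX.crossSpecialRung_iff_oddSpecialRung (oddGenericRung_of_cuspGenericRung hG)).trans
    (oddSpecialRung_iff_cuspSpecialRung hG)

/-- **EXACT RE-LOCATION OF g19's `Spread.SpreadSpecialRung`**: modulo the cusp decided half. [folklore] -/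
theorem spreadSpecialRung_iff_cuspSpecialRung (hG : CuspGenericRung) : Spread.SpreadSpecialRung ↔ CuspSpecialRung :=
  (OddX.spreadSpecialRung_iff_oddSpecialRung (oddGenericRung_of_cuspGenericRung hG)).trans
    (oddSpecialRung_iff_cuspSpecialRung hG)

/-- **EXACT RE-LOCATION OF g14's `PinchSpecialRung`**: modulo the cusp decided half. [folklore] -/
theorem pinchSpecialRung_iff_cuspSpecialRung (hG : CuspGenericRung) : PinchSpecialRung ↔ CuspSpecialRung :=
  (OddX.pinchSpecialRung_iff_oddSpecialRung (oddGenericRung_of_cuspGenericRung hG)).trans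
    (oddSpecialRung_iff_cuspSpecialRung hG)

/-- **EXACT RE-LOCATION OF THE TREE ASIDE 33866** `MaxContactCut.LeafSpecialRung` BY NAME: modulo the cusp decided
half, `LeafSpecialRung ⟺ CuspSpecialRung`. [folklore] -/
theorem leafSpecialRung_iff_cuspSpecialRung (hG : CuspGenericRung) :
    MaxContactCut.LeafSpecialRung ↔ CuspSpecialRung :=
  Leaf.leafSpecialRung_iff_specialRung (L := cuspLeaf) hG

/-- The tree aside 33865 `MaxContactCut.LeafGenericRung` BY NAME from the cusp decided half. [folklore] -/
theorem leafGenericRung_of_cuspGenericRung (hG : CuspGenericRung) : MaxContactCut.LeafGenericRung :=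
  Leaf.leafGenericRung_of_genericRung (L := cuspLeaf) hG

/-- `RungOne` BY NAME from the cusp decided half and the tree's g23 residual (the old residual still closes).
[folklore] -/
theorem closes_of_oddSpecialRung (hG : CuspGenericRung) (hS : OddX.OddSpecialRung) : MaxContactCut.RungOne :=
  closes hG (cuspSpecialRung_of_oddSpecialRung hS)

/-- The tree's g23 `OddX.closes` is RECOVERED from the cusp halves plus engine-free monotonicity (nothing of g23 is
lost). [folklore] -/
theorem odd_closes_of_cusp (hG : CuspGenericRung) (hS : CuspSpecialRung) : MaxContactCut.RungOne :=
  OddX.closes (oddGenericRung_of_cuspGenericRung hG) ((oddSpecialRung_iff_cuspSpecialRung hG).mpr hS)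

end Kernels

end CuspX

end Summit.ResolutionOfSingularities.ResolutionOfSingularities.Theorems.CuspCut
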